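import Mathlib.Analysis.SpecialFunctions.ImproperIntegrals
import Mathlib.MeasureTheory.Integral.IntervalIntegral.FundThmCalculus
import Mathlib.MeasureTheory.Integral.IntegralEqImproper
import Mathlib.Topology.MetricSpace.Contracting
import Mathlib.Topology.ContinuousMap.Bounded.Normed
import HarnessLib

/-!
# Backward Volterra equations on `(-∞, T₀]` with exponentially small kernel

Topic `Probability/RandomPlanarGeometry`. This is the analytic engine of the construction of the
**whole-plane Loewner chain** (G. F. Lawler, *Conformally Invariant Processes in the Plane* (2005),
§4.3, Prop. 4.21: the solution of the whole-plane Loewner equation with the *asymptotic* initial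
condition `gₜ(z) ∼ e^{-t} z`, `t → -∞`). After the substitution `gₜ = e^{-t} hₜ` the whole-plane
(or, after inversion, the radial) Loewner equation becomes an ODE `ḣ = H(t, h)` whose right-hand
side is exponentially small as `t → -∞`, and the asymptotic initial condition becomes the
**backward Volterra integral equation**
```
  m(t) = c + ∫_{-∞}^{t} H(s, m(s)) ds,   t ≤ T₀.
```
We solve it abstractly, for a kernel `H : ℝ → ℂ → ℂ` that is continuous on `(-∞, T₀] × S`,
bounded by `B eˢ` and `L eˢ`-Lipschitz in the state variable on a set `S ⊆ ℂ`
(`VolterraData`): on `(-∞, T₀]` with `L e^{T₀} < 1` the integral operator is a contraction of the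
complete metric space of bounded continuous functions valued in a ball `closedBall c ρ ⊆ S` with
`B e^{T₀} ≤ ρ` (Banach fixed point, `ContractingWith.exists_fixedPoint'`), whence

* `VolterraData.exists_isVolterraSol` — existence of a solution (`IsVolterraSol`);
* `IsVolterraSol.norm_sub_le_of_le` — the a priori bound `‖m t - c‖ ≤ B eᵗ`, `IsVolterraSol.tendsto_atBot`
  — `m t → c` as `t → -∞`, `IsVolterraSol.hasDerivAt` — `m` solves the ODE `ṁ = H(t, m)`;
* `IsVolterraSol.norm_sub_le` — **stability**: two solutions, for data `(c, H)` and `(c', H')`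
  with `‖H - H'‖ ≤ D eˢ` on `S`, differ by at most `(‖c - c'‖ + D e^{T₁})/(1 - L e^{T₁})` on
  `(-∞, T₁]`; in particular **uniqueness** (`IsVolterraSol.eqOn`);
* `isVolterraSol_of_hasDerivAt` — conversely an `S`-valued solution of the ODE on `(-∞, T₁]`
  tending to `c` at `-∞` solves the integral equation (fundamental theorem of calculus and
  `t' → -∞`).

Everything is proved; no named fact is introduced. The file is deliberately free of Loewner
vocabulary (it is used twice downstream: for the trajectories themselves and for their
`w`-derivatives, which solve the linearised equation).

## References

* G. F. Lawler, *Conformally Invariant Processes in the Plane*, AMS (2005), §4.3, Prop. 4.21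
  [Lawler2005].

## Mathlib

`ContractingWith.exists_fixedPoint'`, `BoundedContinuousFunction.ofNormedAddCommGroup`,
`intervalIntegral.integral_Iic_sub_Iic`, `intervalIntegral.integral_hasDerivAt_right`,
`intervalIntegral.integral_eq_sub_of_hasDerivAt`, `MeasureTheory.intervalIntegral_tendsto_integral_Iic`,
`integrableOn_exp_Iic`, `integral_exp_Iic`.
-/

noncomputable section

open Set Filter MeasureTheory Metric
open scoped Topology NNReal BoundedContinuousFunction

namespace Literature.Probability.RandomPlanarGeometry

namespace WholePlaneLoewner

variable {T₀ T₁ : ℝ} {S : Set ℂ} {B B' L L' : ℝ} {H H' : ℝ → ℂ → ℂ} {c c' : ℂ} {m m' : ℝ → ℂ}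

/-- **Volterra data** on `(-∞, T₀] × S`: the kernel `H` is jointly continuous there, bounded by
`B eˢ` and `L eˢ`-Lipschitz in the state variable (`B, L ≥ 0`). [folklore] -/
structure VolterraData (T₀ : ℝ) (S : Set ℂ) (B L : ℝ) (H : ℝ → ℂ → ℂ) : Prop where
  /-- Joint continuity on `(-∞, T₀] × S`. -/
  continuousOn : ContinuousOn (Function.uncurry H) (Iic T₀ ×ˢ S)
  /-- The exponential bound `‖H s x‖ ≤ B eˢ`. -/
  norm_le : ∀ s ≤ T₀, ∀ x ∈ S, ‖H s x‖ ≤ B * Real.exp s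
  /-- The exponential Lipschitz bound `‖H s x - H s y‖ ≤ L eˢ ‖x - y‖`. -/
  norm_sub_le : ∀ s ≤ T₀, ∀ x ∈ S, ∀ y ∈ S, ‖H s x - H s y‖ ≤ L * Real.exp s * ‖x - y‖
  /-- `0 ≤ B`. -/
  nonneg : 0 ≤ B
  /-- `0 ≤ L`. -/
  lip_nonneg : 0 ≤ L

/-- `m` **solves the backward Volterra equation** `m(t) = c + ∫_{-∞}^t H(s, m(s)) ds` on `(-∞, T₁]`
with values in `S`: `m` is continuous on `(-∞, T₁]`, `S`-valued there, and the equation holds for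
every `t ≤ T₁` (the integral being the Bochner integral over `Iic t`). [folklore] -/
def IsVolterraSol (T₁ : ℝ) (S : Set ℂ) (c : ℂ) (H : ℝ → ℂ → ℂ) (m : ℝ → ℂ) : Prop :=
  ContinuousOn m (Iic T₁) ∧ (∀ t ≤ T₁, m t ∈ S) ∧ ∀ t ≤ T₁, m t = c + ∫ s in Iic t, H s (m s)

/-! ### Integrals over `(-∞, t]` of exponentially small functions -/

/-- `‖∫_{(-∞,t]} f‖ ≤ K eᵗ` if `‖f s‖ ≤ K eˢ` on `(-∞, t]` (no integrability hypothesis: a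
non-integrable `f` has integral `0`). [folklore] -/
theorem norm_setIntegral_Iic_le {f : ℝ → ℂ} {K t : ℝ} (hK : ∀ s ≤ t, ‖f s‖ ≤ K * Real.exp s) :
    ‖∫ s in Iic t, f s‖ ≤ K * Real.exp t := by
  have hg : Integrable (fun s ↦ K * Real.exp s) (volume.restrict (Iic t)) :=
    (integrableOn_exp_Iic t).const_mul K
  calc ‖∫ s in Iic t, f s‖ ≤ ∫ s in Iic t, K * Real.exp s :=
        norm_integral_le_of_norm_le hg (ae_restrict_of_forall_mem measurableSet_Iic hK)
    _ = K * Real.exp t := by rw [integral_const_mul, integral_exp_Iic]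

/-- A function bounded by `K eˢ` on `(-∞, t]` and a.e.-strongly measurable there is integrable on
`(-∞, t]`. [folklore] -/
theorem integrableOn_Iic_of_norm_le {f : ℝ → ℂ} {K t : ℝ}
    (hf : AEStronglyMeasurable f (volume.restrict (Iic t)))
    (hK : ∀ s ≤ t, ‖f s‖ ≤ K * Real.exp s) : IntegrableOn f (Iic t) :=
  Integrable.mono' ((integrableOn_exp_Iic t).const_mul K) hf
    (ae_restrict_of_forall_mem measurableSet_Iic hK)

/-- `‖∫_{(-∞,t']} f - ∫_{(-∞,t]} f‖ ≤ M (t' - t)` for `t ≤ t' ≤ T` if `‖f‖ ≤ M` on `(-∞, T]`. [folklore] -/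
theorem norm_integral_Iic_sub_integral_Iic_le {f : ℝ → ℂ} {M T t t' : ℝ} (htt' : t ≤ t')
    (ht' : t' ≤ T) (hf : IntegrableOn f (Iic T)) (hM : ∀ s ≤ T, ‖f s‖ ≤ M) :
    ‖(∫ s in Iic t', f s) - ∫ s in Iic t, f s‖ ≤ M * (t' - t) := by
  rw [intervalIntegral.integral_Iic_sub_Iic (hf.mono_set (Iic_subset_Iic.2 (htt'.trans ht')))
    (hf.mono_set (Iic_subset_Iic.2 ht'))]
  have := intervalIntegral.norm_integral_le_of_norm_le_const (a := t) (b := t') (C := M)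
    (f := f) fun s hs ↦ hM s (by
      rw [uIoc_of_le htt'] at hs
      exact hs.2.trans ht')
  rwa [abs_of_nonneg (sub_nonneg.2 htt')] at this

/-! ### The integrand along an `S`-valued continuous curve -/

/-- Along a continuous `S`-valued curve on `(-∞, T₁]`, `T₁ ≤ T₀`, the integrand `s ↦ H(s, m s)` is
continuous on `(-∞, T₁]`. [folklore] -/
theorem VolterraData.continuousOn_comp (hH : VolterraData T₀ S B L H) (hT : T₁ ≤ T₀)
    (hm : ContinuousOn m (Iic T₁)) (hmS : ∀ s ≤ T₁, m s ∈ S) :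
    ContinuousOn (fun s ↦ H s (m s)) (Iic T₁) := by
  have : (fun s ↦ H s (m s)) = Function.uncurry H ∘ fun s ↦ (s, m s) := rfl
  rw [this]
  refine hH.continuousOn.comp (continuousOn_id.prodMk hm) fun s hs ↦ ?_
  exact ⟨show s ≤ T₀ from le_trans hs hT, hmS s hs⟩

/-- … and bounded by `B eˢ` there. [folklore] -/
theorem VolterraData.norm_comp_le (hH : VolterraData T₀ S B L H) (hT : T₁ ≤ T₀)
    (hmS : ∀ s ≤ T₁, m s ∈ S) : ∀ s ≤ T₁, ‖H s (m s)‖ ≤ B * Real.exp s :=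
  fun s hs ↦ hH.norm_le s (hs.trans hT) _ (hmS s hs)

/-- … hence integrable on every `(-∞, t]`, `t ≤ T₁`. [folklore] -/
theorem VolterraData.integrableOn_comp (hH : VolterraData T₀ S B L H) (hT : T₁ ≤ T₀)
    (hm : ContinuousOn m (Iic T₁)) (hmS : ∀ s ≤ T₁, m s ∈ S) {t : ℝ} (ht : t ≤ T₁) :
    IntegrableOn (fun s ↦ H s (m s)) (Iic t) :=
  integrableOn_Iic_of_norm_le
    (((hH.continuousOn_comp hT hm hmS).mono (Iic_subset_Iic.2 ht)).aestronglyMeasurable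
      measurableSet_Iic)
    fun s hs ↦ hH.norm_comp_le hT hmS s (hs.trans ht)

/-! ### A priori bound, limit at `-∞`, and the ODE -/

namespace IsVolterraSol

/-- A solution is continuous on `(-∞, T₁]`. [folklore] -/
theorem continuousOn (h : IsVolterraSol T₁ S c H m) : ContinuousOn m (Iic T₁) := h.1

/-- A solution is `S`-valued on `(-∞, T₁]`. [folklore] -/
theorem mem (h : IsVolterraSol T₁ S c H m) {t : ℝ} (ht : t ≤ T₁) : m t ∈ S := h.2.1 t ht

/-- The integral equation. [folklore] -/
theorem eq (h : IsVolterraSol T₁ S c H m) {t : ℝ} (ht : t ≤ T₁) :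
    m t = c + ∫ s in Iic t, H s (m s) := h.2.2 t ht

/-- Restricting the time range of a solution gives a solution. [folklore] -/
theorem mono (h : IsVolterraSol T₁ S c H m) {T₂ : ℝ} (hT : T₂ ≤ T₁) : IsVolterraSol T₂ S c H m :=
  ⟨h.1.mono (Iic_subset_Iic.2 hT), fun t ht ↦ h.2.1 t (ht.trans hT),
    fun t ht ↦ h.2.2 t (ht.trans hT)⟩

/-- **A priori bound**: `‖m t - c‖ ≤ B eᵗ` for `t ≤ T₁ ≤ T₀`. [folklore] -/
theorem norm_sub_le_of_le (h : IsVolterraSol T₁ S c H m) (hH : VolterraData T₀ S B L H)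
    (hT : T₁ ≤ T₀) {t : ℝ} (ht : t ≤ T₁) : ‖m t - c‖ ≤ B * Real.exp t := by
  rw [h.eq ht, add_sub_cancel_left]
  exact norm_setIntegral_Iic_le fun s hs ↦ hH.norm_comp_le hT h.2.1 s (hs.trans ht)

/-- **The asymptotic initial value**: `m t → c` as `t → -∞`. [folklore] -/
theorem tendsto_atBot (h : IsVolterraSol T₁ S c H m) (hH : VolterraData T₀ S B L H)
    (hT : T₁ ≤ T₀) : Tendsto m atBot (𝓝 c) := by
  rw [tendsto_iff_norm_sub_tendsto_zero]
  have h0 : Tendsto (fun t ↦ B * Real.exp t) atBot (𝓝 0) := by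
    simpa using Real.tendsto_exp_atBot.const_mul B
  refine squeeze_zero_norm' ?_ h0
  filter_upwards [eventually_le_atBot T₁] with t ht
  rw [norm_norm]
  exact h.norm_sub_le_of_le hH hT ht

/-- **A Volterra solution solves the ODE** `ṁ = H(t, m)` at every `t < T₁` (`T₁ ≤ T₀`): the
right-hand side is continuous along `m`, so the primitive over `(-∞, t]` is differentiable
(fundamental theorem of calculus). [folklore] -/
theorem hasDerivAt (h : IsVolterraSol T₁ S c H m) (hH : VolterraData T₀ S B L H) (hT : T₁ ≤ T₀)
    {t : ℝ} (ht : t < T₁) : HasDerivAt m (H t (m t)) t := by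
  -- the clamped integrand, continuous on `ℝ` and bounded by `B eˢ`
  set f : ℝ → ℂ := fun s ↦ H s (m s) with hf
  set g : ℝ → ℂ := fun s ↦ f (min s T₁) with hg
  have hfc : ContinuousOn f (Iic T₁) := hH.continuousOn_comp hT h.continuousOn h.2.1
  have hgc : Continuous g := by
    have : g = f ∘ fun s ↦ min s T₁ := rfl
    rw [this]
    exact hfc.comp_continuous (continuous_id.min continuous_const) fun s ↦
      mem_Iic.2 (min_le_right _ _)
  have hgf : ∀ s ≤ T₁, g s = f s := fun s hs ↦ by simp [hg, min_eq_left hs]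
  have hgB : ∀ s, ‖g s‖ ≤ B * Real.exp s := fun s ↦ by
    have h1 : ‖g s‖ ≤ B * Real.exp (min s T₁) :=
      hH.norm_comp_le hT h.2.1 (min s T₁) (min_le_right _ _)
    exact h1.trans (mul_le_mul_of_nonneg_left (Real.exp_le_exp.2 (min_le_left _ _)) hH.nonneg)
  have hgi : ∀ u, IntegrableOn g (Iic u) := fun u ↦
    integrableOn_Iic_of_norm_le hgc.aestronglyMeasurable.restrict fun s _ ↦ hgB s
  -- `u ↦ ∫_{(-∞,u]} g` has derivative `g t` at `t`
  set a : ℝ := t - 1 with ha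
  have hFTC : HasDerivAt (fun u ↦ ∫ s in a..u, g s) (g t) t :=
    intervalIntegral.integral_hasDerivAt_right (hgc.intervalIntegrable _ _)
      (hgc.stronglyMeasurableAtFilter _ _) hgc.continuousAt
  have hF : HasDerivAt (fun u ↦ ∫ s in Iic u, g s) (g t) t := by
    have heq : (fun u ↦ ∫ s in Iic u, g s) = fun u ↦ (∫ s in Iic a, g s) + ∫ s in a..u, g s := by
      funext u
      rw [← intervalIntegral.integral_Iic_sub_Iic (hgi a) (hgi u)]
      ring
    rw [heq]
    exact (hasDerivAt_const t _).add hFTC |>.congr_deriv (by simp)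
  -- `m = c + ∫_{(-∞,·]} g` near `t`
  have hev : (fun u ↦ c + ∫ s in Iic u, g s) =ᶠ[𝓝 t] m := by
    filter_upwards [Iio_mem_nhds ht] with u hu
    rw [h.eq hu.le, setIntegral_congr_fun measurableSet_Iic fun s hs ↦ hgf s (le_trans hs hu.le)]
  have := ((hasDerivAt_const t c).add hF).congr_of_eventuallyEq hev.symm
  simpa [hgf t ht.le] using this

/-- **Stability / uniqueness.** Let `m` solve the equation for `(c, H)` and `m'` for `(c', H')` on
`(-∞, T₁]`, `T₁ ≤ T₀`, both `S`-valued, where `H` is Volterra data with Lipschitz constant `L`,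
`L e^{T₁} < 1`, `H'` is Volterra data, and `‖H(s, x) - H'(s, x)‖ ≤ D eˢ` on `(-∞, T₁] × S`. Then
`‖m t - m' t‖ ≤ (‖c - c'‖ + D e^{T₁}) / (1 - L e^{T₁})` for all `t ≤ T₁` (compare the suprema over
`(-∞, T₁]`; no Grönwall lemma is needed since the kernel is a contraction). [folklore] -/
theorem norm_sub_le (h : IsVolterraSol T₁ S c H m) (h' : IsVolterraSol T₁ S c' H' m')
    (hH : VolterraData T₀ S B L H) (hH' : VolterraData T₀ S B' L' H') (hT : T₁ ≤ T₀)
    (hL : L * Real.exp T₁ < 1) {D : ℝ} (hD0 : 0 ≤ D)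
    (hD : ∀ s ≤ T₁, ∀ x ∈ S, ‖H s x - H' s x‖ ≤ D * Real.exp s) {t : ℝ} (ht : t ≤ T₁) :
    ‖m t - m' t‖ ≤ (‖c - c'‖ + D * Real.exp T₁) / (1 - L * Real.exp T₁) := by
  -- the supremum `M` of `‖m - m'‖` over `(-∞, T₁]`
  set M₀ : ℝ := ‖c - c'‖ + (B + B') * Real.exp T₁ with hM₀
  have hbd : ∀ u ≤ T₁, ‖m u - m' u‖ ≤ M₀ := by
    intro u hu
    have h1 := h.norm_sub_le_of_le hH hT hu
    have h2 := h'.norm_sub_le_of_le hH' hT hu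
    have h3 : Real.exp u ≤ Real.exp T₁ := Real.exp_le_exp.2 hu
    calc ‖m u - m' u‖ = ‖(m u - c) - (m' u - c') + (c - c')‖ := by ring_nf
      _ ≤ ‖m u - c‖ + ‖m' u - c'‖ + ‖c - c'‖ :=
          (norm_add_le _ _).trans (add_le_add (_root_.norm_sub_le _ _) le_rfl)
      _ ≤ B * Real.exp T₁ + B' * Real.exp T₁ + ‖c - c'‖ := by
          gcongr
          · exact h1.trans (mul_le_mul_of_nonneg_left h3 hH.nonneg)
          · exact h2.trans (mul_le_mul_of_nonneg_left h3 hH'.nonneg)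
      _ = M₀ := by rw [hM₀]; ring
  haveI : Nonempty (Iic T₁) := ⟨⟨T₁, mem_Iic.2 le_rfl⟩⟩
  set M : ℝ := ⨆ u : Iic T₁, ‖m u - m' u‖ with hMdef
  have hMbdd : BddAbove (range fun u : Iic T₁ ↦ ‖m u - m' u‖) :=
    ⟨M₀, by rintro _ ⟨u, rfl⟩; exact hbd u u.2⟩
  have hleM : ∀ u ≤ T₁, ‖m u - m' u‖ ≤ M := fun u hu ↦
    le_ciSup (f := fun u : Iic T₁ ↦ ‖m u - m' u‖) hMbdd ⟨u, hu⟩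
  have hM0 : 0 ≤ M := (norm_nonneg _).trans (hleM T₁ le_rfl)
  -- the key pointwise estimate `‖m u - m' u‖ ≤ ‖c - c'‖ + (L M + D) e^{T₁}`
  have hkey : ∀ u ≤ T₁, ‖m u - m' u‖ ≤ ‖c - c'‖ + (L * M + D) * Real.exp T₁ := by
    intro u hu
    have hi := hH.integrableOn_comp hT h.continuousOn h.2.1 hu
    have hi' := hH'.integrableOn_comp hT h'.continuousOn h'.2.1 hu
    have hdiff : m u - m' u = (c - c') + ∫ s in Iic u, (H s (m s) - H' s (m' s)) := by
      rw [h.eq hu, h'.eq hu, integral_sub hi hi']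
      ring
    have hpt : ∀ s ≤ u, ‖H s (m s) - H' s (m' s)‖ ≤ (L * M + D) * Real.exp s := by
      intro s hs
      have hs₁ : s ≤ T₁ := hs.trans hu
      have e1 := hH.norm_sub_le s (hs₁.trans hT) _ (h.mem hs₁) _ (h'.mem hs₁)
      have e2 := hD s hs₁ _ (h'.mem hs₁)
      calc ‖H s (m s) - H' s (m' s)‖
          = ‖(H s (m s) - H s (m' s)) + (H s (m' s) - H' s (m' s))‖ := by ring_nf
        _ ≤ L * Real.exp s * ‖m s - m' s‖ + D * Real.exp s := (norm_add_le _ _).trans (add_le_add e1 e2)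
        _ ≤ L * Real.exp s * M + D * Real.exp s := by
            gcongr
            · exact mul_nonneg hH.lip_nonneg (Real.exp_pos s).le
            · exact hleM s hs₁
        _ = (L * M + D) * Real.exp s := by ring
    have hI := norm_setIntegral_Iic_le hpt
    have hLMD : 0 ≤ L * M + D := add_nonneg (mul_nonneg hH.lip_nonneg hM0) hD0
    rw [hdiff]
    calc ‖(c - c') + ∫ s in Iic u, (H s (m s) - H' s (m' s))‖
        ≤ ‖c - c'‖ + (L * M + D) * Real.exp u := (norm_add_le _ _).trans (add_le_add le_rfl hI)
      _ ≤ ‖c - c'‖ + (L * M + D) * Real.exp T₁ := by gcongr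
  have hMle : M ≤ ‖c - c'‖ + (L * M + D) * Real.exp T₁ :=
    ciSup_le fun u ↦ hkey u u.2
  have hden : 0 < 1 - L * Real.exp T₁ := sub_pos.2 hL
  have hM' : M ≤ (‖c - c'‖ + D * Real.exp T₁) / (1 - L * Real.exp T₁) := by
    rw [le_div_iff₀ hden]
    nlinarith
  exact (hleM t ht).trans hM'

/-- **Uniqueness** of `S`-valued solutions on `(-∞, T₁]` (`T₁ ≤ T₀`, `L e^{T₁} < 1`). [folklore] -/
theorem eqOn (h : IsVolterraSol T₁ S c H m) (h' : IsVolterraSol T₁ S c H m')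
    (hH : VolterraData T₀ S B L H) (hT : T₁ ≤ T₀) (hL : L * Real.exp T₁ < 1) :
    EqOn m m' (Iic T₁) := by
  intro t ht
  have := h.norm_sub_le h' hH hH hT hL le_rfl (D := 0) (fun s _ x _ ↦ by simp) ht
  rw [sub_self, norm_zero, zero_mul, zero_add, zero_div] at this
  exact sub_eq_zero.1 (norm_le_zero_iff.1 this)

end IsVolterraSol

/-! ### From the ODE back to the integral equation -/

/-- **An `S`-valued solution of the ODE tending to `c` at `-∞` solves the Volterra equation**: if
`ṅ = H(t, n)` at every `t ≤ T₁` (`T₁ ≤ T₀`), `n` is `S`-valued on `(-∞, T₁]` and `n t → c` as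
`t → -∞`, then `n(t) = c + ∫_{-∞}^t H(s, n(s)) ds` for `t ≤ T₁`. [folklore] -/
theorem isVolterraSol_of_hasDerivAt (hH : VolterraData T₀ S B L H) (hT : T₁ ≤ T₀) {n : ℝ → ℂ}
    (hder : ∀ t ≤ T₁, HasDerivAt n (H t (n t)) t) (hnS : ∀ t ≤ T₁, n t ∈ S)
    (hlim : Tendsto n atBot (𝓝 c)) : IsVolterraSol T₁ S c H n := by
  have hnc : ContinuousOn n (Iic T₁) := fun t ht ↦ (hder t ht).continuousAt.continuousWithinAt
  refine ⟨hnc, hnS, fun t ht ↦ ?_⟩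
  have hfc : ContinuousOn (fun s ↦ H s (n s)) (Iic T₁) := hH.continuousOn_comp hT hnc hnS
  have hfi : IntegrableOn (fun s ↦ H s (n s)) (Iic t) := hH.integrableOn_comp hT hnc hnS ht
  -- FTC on `[a, t]`
  have hFTC : ∀ a ≤ t, ∫ s in a..t, H s (n s) = n t - n a := by
    intro a ha
    refine intervalIntegral.integral_eq_sub_of_hasDerivAt (fun s hs ↦ ?_) ?_
    · rw [uIcc_of_le ha] at hs
      exact hder s (hs.2.trans ht)
    · exact (hfc.mono (by rw [uIcc_of_le ha]; exact fun s hs ↦ hs.2.trans ht)).intervalIntegrable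
  -- let `a → -∞`
  have h1 : Tendsto (fun a ↦ ∫ s in a..t, H s (n s)) atBot (𝓝 (∫ s in Iic t, H s (n s))) :=
    intervalIntegral_tendsto_integral_Iic t hfi tendsto_id
  have h2 : Tendsto (fun a ↦ ∫ s in a..t, H s (n s)) atBot (𝓝 (n t - c)) := by
    have : Tendsto (fun a ↦ n t - n a) atBot (𝓝 (n t - c)) := tendsto_const_nhds.sub hlim
    refine this.congr' ?_
    filter_upwards [eventually_le_atBot t] with a ha
    exact (hFTC a ha).symm
  have := tendsto_nhds_unique h2 h1
  rw [← this]
  ring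

/-! ### Existence: the Banach fixed point -/

/-- **Existence of the Volterra solution.** For Volterra data `H` on `(-∞, T₀] × S`, a centre `c`
with `closedBall c ρ ⊆ S`, `B e^{T₀} ≤ ρ` and `L e^{T₀} < 1`, the equation
`m(t) = c + ∫_{-∞}^t H(s, m(s)) ds` has a solution on `(-∞, T₀]` with values in `closedBall c ρ`:
the operator `m ↦ c + ∫_{-∞}^{min(·, T₀)} H(s, m(s)) ds` is an `L e^{T₀}`-contraction of the closed
ball of radius `ρ` about the constant `c` in the Banach space of bounded continuous functions
`ℝ → ℂ`. (Lawler (2005), proof of Prop. 4.21, obtains the solution as a limit `s → -∞` of solutions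
started at time `s`; the fixed-point formulation is the same estimate.) [cite: Lawler2005, Prop. 4.21] -/
theorem VolterraData.exists_isVolterraSol (hH : VolterraData T₀ S B L H) {ρ : ℝ}
    (hS : closedBall c ρ ⊆ S) (hBρ : B * Real.exp T₀ ≤ ρ) (hL : L * Real.exp T₀ < 1) :
    ∃ m, IsVolterraSol T₀ S c H m ∧ ∀ t, m t ∈ closedBall c ρ := by
  classical
  have hρ : 0 ≤ ρ := le_trans (mul_nonneg hH.nonneg (Real.exp_pos _).le) hBρ
  have hθ0 : 0 ≤ L * Real.exp T₀ := mul_nonneg hH.lip_nonneg (Real.exp_pos _).le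
  set X := ℝ →ᵇ ℂ
  set K : Set X := closedBall (BoundedContinuousFunction.const ℝ c) ρ with hK
  -- members of `K` are continuous, ball-valued, hence `S`-valued
  have hKval : ∀ f ∈ K, ∀ s, (f : ℝ → ℂ) s ∈ closedBall c ρ := by
    intro f hf s
    rw [hK, mem_closedBall, BoundedContinuousFunction.dist_le hρ] at hf
    simpa [mem_closedBall] using hf s
  have hKS : ∀ f ∈ K, ∀ s ≤ T₀, (f : ℝ → ℂ) s ∈ S := fun f hf s _ ↦ hS (hKval f hf s)
  -- the integral functional `g f t = c + ∫_{(-∞, min t T₀]} H(s, f s) ds` for `f ∈ K`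
  set g : X → ℝ → ℂ := fun f t ↦ c + ∫ s in Iic (min t T₀), H s (f s) with hg
  have hgi : ∀ f ∈ K, ∀ t ≤ T₀, IntegrableOn (fun s ↦ H s (f s)) (Iic t) := fun f hf t ht ↦
    hH.integrableOn_comp le_rfl f.continuous.continuousOn (hKS f hf) ht
  have hgsub : ∀ f ∈ K, ∀ t, ‖g f t - c‖ ≤ B * Real.exp (min t T₀) := by
    intro f hf t
    simp only [hg, add_sub_cancel_left]
    exact norm_setIntegral_Iic_le
      fun s hs ↦ hH.norm_comp_le le_rfl (hKS f hf) s (hs.trans (min_le_right _ _))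
  have hgball : ∀ f ∈ K, ∀ t, ‖g f t - c‖ ≤ ρ := fun f hf t ↦
    (hgsub f hf t).trans ((mul_le_mul_of_nonneg_left (Real.exp_le_exp.2 (min_le_right _ _))
      hH.nonneg).trans hBρ)
  have hgbd : ∀ f ∈ K, ∀ t, ‖g f t‖ ≤ ‖c‖ + ρ := fun f hf t ↦ by
    calc ‖g f t‖ = ‖(g f t - c) + c‖ := by rw [sub_add_cancel]
      _ ≤ ‖g f t - c‖ + ‖c‖ := norm_add_le _ _
      _ ≤ ρ + ‖c‖ := by gcongr; exact hgball f hf t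
      _ = ‖c‖ + ρ := add_comm _ _
  have hglip : ∀ f ∈ K, ∀ t t', ‖g f t - g f t'‖ ≤ B * Real.exp T₀ * |t - t'| := by
    -- the integral over `(min t' T₀, min t T₀]` of a function bounded by `B e^{T₀}`
    have key : ∀ f ∈ K, ∀ t t', t' ≤ t → ‖g f t - g f t'‖ ≤ B * Real.exp T₀ * (t - t') := by
      intro f hf t t' htt'
      have hmin : min t' T₀ ≤ min t T₀ := min_le_min_right _ htt'
      have h1 := norm_integral_Iic_sub_integral_Iic_le hmin (min_le_right _ _)
        (hgi f hf T₀ le_rfl) (M := B * Real.exp T₀) fun s hs ↦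
          (hH.norm_comp_le le_rfl (hKS f hf) s hs).trans
            (mul_le_mul_of_nonneg_left (Real.exp_le_exp.2 hs) hH.nonneg)
      have h2 : min t T₀ - min t' T₀ ≤ t - t' := by
        rcases le_total t T₀ with h | h
        · rw [min_eq_left h, min_eq_left (htt'.trans h)]
        · rw [min_eq_right h]
          have := min_le_left t' T₀
          have := min_le_right t' T₀
          rcases le_total t' T₀ with h' | h'
          · rw [min_eq_left h']; linarith
          · rw [min_eq_right h']; linarith
      have h3 : g f t - g f t' = (∫ s in Iic (min t T₀), H s (f s)) -
          ∫ s in Iic (min t' T₀), H s (f s) := by simp only [hg]; ring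
      rw [h3]
      exact h1.trans (mul_le_mul_of_nonneg_left h2 (mul_nonneg hH.nonneg (Real.exp_pos _).le))
    intro f hf t t'
    rcases le_total t' t with h | h
    · rw [abs_of_nonneg (sub_nonneg.2 h)]
      exact key f hf t t' h
    · rw [← norm_neg, neg_sub, abs_sub_comm, abs_of_nonneg (sub_nonneg.2 h)]
      exact key f hf t' t h
  have hgc : ∀ f ∈ K, Continuous (g f) := by
    intro f hf
    refine (LipschitzWith.of_dist_le_mul (K := (B * Real.exp T₀).toNNReal) fun t t' ↦ ?_).continuous
    rw [dist_eq_norm, dist_eq_norm, Real.coe_toNNReal _ (mul_nonneg hH.nonneg (Real.exp_pos _).le)]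
    exact hglip f hf t t'
  -- the operator
  set Φ : X → X := fun f ↦ if hf : f ∈ K then
      BoundedContinuousFunction.ofNormedAddCommGroup (g f) (hgc f hf) (‖c‖ + ρ) (hgbd f hf)
    else f with hΦ
  have hΦapply : ∀ f ∈ K, ∀ t, (Φ f : ℝ → ℂ) t = g f t := by
    intro f hf t
    simp only [hΦ, dif_pos hf]
    rfl
  have hmaps : MapsTo Φ K K := by
    intro f hf
    rw [hK, mem_closedBall, BoundedContinuousFunction.dist_le hρ]
    intro t
    rw [hΦapply f hf t, BoundedContinuousFunction.const_apply, dist_eq_norm]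
    exact hgball f hf t
  -- contraction
  set θ : ℝ≥0 := (L * Real.exp T₀).toNNReal with hθ
  have hθcoe : (θ : ℝ) = L * Real.exp T₀ := Real.coe_toNNReal _ hθ0
  have hθ1 : θ < 1 := by
    rw [← NNReal.coe_lt_coe, hθcoe, NNReal.coe_one]
    exact hL
  have hlipΦ : LipschitzOnWith θ Φ K := by
    refine LipschitzOnWith.of_dist_le_mul fun f hf f' hf' ↦ ?_
    rw [hθcoe, BoundedContinuousFunction.dist_le (mul_nonneg hθ0 dist_nonneg)]
    intro t
    rw [hΦapply f hf t, hΦapply f' hf' t, dist_eq_norm]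
    have hi := hgi f hf _ (min_le_right t T₀)
    have hi' := hgi f' hf' _ (min_le_right t T₀)
    have hdiff : g f t - g f' t = ∫ s in Iic (min t T₀), (H s (f s) - H s (f' s)) := by
      simp only [hg]
      rw [integral_sub hi hi']
      ring
    rw [hdiff]
    have hpt : ∀ s ≤ min t T₀, ‖H s (f s) - H s (f' s)‖ ≤ L * dist f f' * Real.exp s := by
      intro s hs
      have hs₀ : s ≤ T₀ := hs.trans (min_le_right _ _)
      calc ‖H s (f s) - H s (f' s)‖ ≤ L * Real.exp s * ‖f s - f' s‖ :=
            hH.norm_sub_le s hs₀ _ (hKS f hf s hs₀) _ (hKS f' hf' s hs₀)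
        _ ≤ L * Real.exp s * dist f f' := by
            gcongr
            · exact mul_nonneg hH.lip_nonneg (Real.exp_pos s).le
            · rw [← dist_eq_norm]; exact BoundedContinuousFunction.dist_coe_le_dist s
        _ = L * dist f f' * Real.exp s := by ring
    calc ‖∫ s in Iic (min t T₀), (H s (f s) - H s (f' s))‖
        ≤ L * dist f f' * Real.exp (min t T₀) := norm_setIntegral_Iic_le hpt
      _ ≤ L * dist f f' * Real.exp T₀ := by
          gcongr
          · exact mul_nonneg hH.lip_nonneg dist_nonneg
          · exact min_le_right _ _
      _ = L * Real.exp T₀ * dist f f' := by ring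
  have hcontr : ContractingWith θ (hmaps.restrict Φ K K) := ⟨hθ1, hlipΦ.mapsToRestrict hmaps⟩
  have hcK : BoundedContinuousFunction.const ℝ c ∈ K := mem_closedBall_self hρ
  obtain ⟨f, hfK, hfix, -⟩ :=
    hcontr.exists_fixedPoint' isClosed_closedBall.isComplete hmaps hcK (edist_ne_top _ _)
  -- the fixed point solves the equation
  refine ⟨f, ⟨f.continuous.continuousOn, hKS f hfK, fun t ht ↦ ?_⟩, hKval f hfK⟩
  have h1 : (f : ℝ → ℂ) t = g f t := by
    have := congrArg (fun h : X ↦ (h : ℝ → ℂ) t) hfix.eq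
    simpa [hΦapply f hfK t] using this.symm
  rw [h1]
  simp only [hg, min_eq_left ht]

end WholePlaneLoewner

end Literature.Probability.RandomPlanarGeometry
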